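import Literature.MathematicalPhysics.QuantumFieldTheory.Balaban1983to89.B15Sect1Instances
import Literature.MathematicalPhysics.QuantumFieldTheory.Balaban1983to89.B15StandardRep

/-!
# `Balaban1983to89.B15Sect1ChartInstances` — T. Bałaban, *Large field renormalization. I. The basic step of the 𝐑 operation*,
# Commun. Math. Phys. **122** (1989) 175–202 [Balaban1989LargeFieldI] = «[IV]», §1: PRINT'S OWN INSTANCES of the
# CHART-LETTER displays — (1.53)₃ `B′_j = (1/i) log V′_j` with the scaling `B′_j = g_jB_j` (p. 187), (1.55) `χ′^{(j)}`,
# (1.59), (1.81)–(1.82) `V″ = V′V₀`, `χ′`, `V′ = exp iB′` on `𝔹₀ = 𝔹″_k ∩ Λ₀`, and (1.101) `χ(Λ_i)` — r12's letter-level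
# predicates `B15.PrelimIntegrations.SF155` ∕ `SF159` ∕ `SF182` ∕ `B15.BasicStep.Chi101` taken AT the exponential chart
# of record `B15StandardRep.LieChart` (`expI = exp i(·)`, `logI = (1/i) log`), AT the bond sets of record, and AT the
# fluctuation fields of record (r11's `B15Sect1Instances.fluct153std`, r12's `fluct153`)

statement-level skeleton of published theorems with citation tags; proofs where landed; nothing here is a claim about
the Yang–Mills mass gap

PDF held: `paper:balaban1989-cmp122-large-field-i` (journal page = PDF page + 174).  The displays below were READ AS IMAGES
by this seat on the ×2 renders `run/shared/lean/pub/pub-balaban/b2b-balaban-ref1/pages/1989-cmp122-large-field-I/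
1989-cmp122-large-field-I-p013-x2.png` (p. 187), `…-p014-x2.png` (p. 188), `…-p021-x2.png` (p. 195), `…-p022-x2.png`
(p. 196), `…-p027-x2.png` (p. 201).  [III] = T. Bałaban, *Convergent renormalization expansions for lattice gauge theories*,
Commun. Math. Phys. **119** (1988) 243–285 [Balaban1988Convergent].

CITATION HEADER / WHAT IS REPRODUCED (mega-formalization `lit-balaban`, HOME `run/shared/lean/pub/lit-balaban/`; Phase-2
proof seat `lit-balaban-p29` gen 41 acting under the free-target protocol G.5-34 (d) on block B15, whose fold owner r12 is
auto-wake-gated and whose PROXY constituent under G.5-61 is r11; companion document `lit-balaban-r11/READING-RULE-PREAUDIT-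
B15-r11-g109.md` §5: *"Chart-letter rows (instance needs the exponential chart of the integration variable …): Eq1.55,
1.59, 1.82, 1.101"*).  SKELETON rows served (cells; heads are the lead's ∕ the PROXY file's business): **B15.Eq1.55,
B15.Eq1.59, B15.Eq1.82, B15.Eq1.101**, with member records on **B15.Eq1.53** (third member `B′_j = (1/i) log V′_j` and the
scaling sentence of p. 187) and **B15.Eq1.81** (`Λ₀`, `𝔹₀`, `V₀ = M_{𝔹″_k}(U₀)` and the p. 195 bond convention).

THE PRINT (verbatim).  p. 187 (1.53): *"We introduce the fluctuation field V′_j on (Ω^c_{j+1}∖Z″_j)^{(j)}, V′_j =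
V_j(V^{(j)})^{−1}, V^{(j)} = M^j(U_k^{(n+1)}), B′_j = (1/i) log V′_j. (1.53)"*; *"This field is small … < 3δ′_j, (1.54) …
Thus B′_j is small, |B′_j| < 6δ′_j, and we expand all the expressions in the integral with respect to B′_j … and finally
we perform the scaling transformation B′_j = g_jB_j."*  p. 188 (1.55): *"In the obtained integral we introduce the
decomposition of unity 1 = χ′^{(j)} + (1 − χ′^{(j)}) in each component of Z, where χ′^{(j)} = χ({|B_j(b)| < δ′_j for
b∈(Ω^c_{j+1}∖Z″_{j+1})^{(j)*}}). (1.55)"*; (1.59): *"Now we make the change of variables (1.22) [III], with ℍ_Z^{(j)} instead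
of ℍ_{1,Ax}, for the bonds belonging to (Ω^c_{j+1}∖Z″_{j+1})^{(j)*} … This change of variables transforms the function
χ′_j(1 − χ′^{(j)}) into χ({|exp ig_jB_j(b) − 1| < 2δ′_j for b∈(Ω^c_{j+1}∖Z″_{j+1})^{(j)*}})(1 − χ′^{(j)}), (1.59) which has
the required property, in fact it does not depend at all on the background fields."*  p. 195 (1.81): *"Now we define the
fluctuation field V′ on the set 𝔹″_k∩Λ∩Ω″^{∼2}_{h+1}. … denote Λ₀ = Λ∩Ω″^{∼2}_{h+1}. We put V″ = V′V₀ on Λ₀, V₀ =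
M_{𝔹″_k}(U₀). (1.81) More precisely the equality is on the set 𝔹₀ = 𝔹″_k∩Λ₀. Let us recall that according to our
convention, bonds intersecting ∂Λ belong to 𝔹₀, and bonds intersecting ∂Ω″^{∼2}_{h+1} do not belong to 𝔹₀."*  p. 196
(1.82): *"We introduce stronger restrictions on the fluctuation field by the decomposition of unity 1 = χ′ + (1 − χ′),
where χ′ = χ({|B′(b)| < δ′_k for b∈𝔹₀}), (1.82) and V′ = exp iB′."*  p. 201 (1.101): *"χ(Λ_i) = χ({|(1/i) log V′(b)| <
M₀ε_k for b∈Λ_i}). (1.101)"* (the insert of (1.100) is `δ_{G_i}(V′_k)χ(Λ_i)exp[−g_k⁻²A(ζ_i, U_{k,X_i}(V′_kV_{Λ_i}))]`, so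
`V′_k = V_kV_{Λ_i}^{−1}` is the fluctuation of the scale-`k` variable around the Proposition-1 minimizer `V_{Λ_i}`).

WHY.  r12 typed these displays (p239014, `B15.PrelimIntegrations`; `B15.BasicStep.Chi101`) WITH BODY but over an ABSTRACT
normed letter (`Bj : B → V`, `B' : B → V`, `logV' : B → ℝ`) and an abstract bond set, because the tree then had neither an
exponential chart of the gauge group nor the regions ∕ fluctuation fields of [IV] §1 as objects.  Both exist now: r12's
B15-native chart `B15StandardRep.LieChart G 𝔤` (p243580; `expMul`, `logRatio`), r12's regions and determining sets
(`B15DeterminingSets`: `pts`, `bondsOf`, `detSetTop` = `𝔹″_k`, `avgFamily` = `M_𝐁(·)`), r11's print-instances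
(`B15Sect1Instances`: `fluct153std` = `V′_j`, `vZstd` = `V_Z^{(j)}`, `chi127std` = (1.27) on the bond set
`bondsOf (pts j ((Ω (j+1))ᶜ ∖ Zpp (j+1)))` = *"(Ω^c_{j+1}∖Z″_{j+1})^{(j)*}"*, `bgU0std` = `U₀` of (1.79), `IsVLambdaStd` =
Prop. 1's `V_Λ`).  This file threads them through (1.53)₃, (1.55), (1.59), (1.81)–(1.82), (1.101), so that each of these
displays is typed AT PRINT'S OWN instance (the lead's READING RULE FOR DEFINITION DISPLAYS, clause (a)): the integration
variables `B_j`, `B′` are free `𝔤`-valued bond fields on the printed bond sets (they ARE the new integration variables after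
the change of variables), the tested group elements are `expI (g_j • B_j(b))`, `expI (B′(b))` through the chart, and the
link to the old variables is the chart identity `B′ = (1/i) log[V″V₀⁻¹]` = `logRatio`.

HONEST SCOPE.  (i) `LieChart` carries NO analytic law (r12's READING (a) of `B15StandardRep`): where print uses
`log ∘ exp = id` near `1` or `|(1/i) log W| ≦ 2|W − 1|` (p. 187 *"Thus B′_j is small, |B′_j| < 6δ′_j"*), the law enters as a
located hypothesis on the chart (`hlogexp`, `hlog`), discharged in the matrix models elsewhere (`B15SmallField185` §6,
`BlockAveragingFederbushGValued.LogChart`).  (ii) The change of variables (1.22) [III] itself (its Jacobian, the new terms in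
the action) is NOT formalized here; its effect on the characteristic functions — the substitution
`V_j(b)(V_Z^{(j)}(b))⁻¹ = exp ig_jB_j(b)` on the printed bond set — enters `chi127std_iff_sf159std_of_subst` as the
hypothesis `hsub`; *"it does not depend at all on the background fields"* holds BY CONSTRUCTION (`chi159std` has no
background argument).  (iii) The enlarged region `Ω″^{∼2}_{h+1}` is an explicit argument `ΩppT2 ⊂ T_η` (as r13's
`B16Sect1Backgrounds.Sect1Data.ΩppT2`); the p. 195 bond convention is implemented verbatim (`bondsB0`: bonds meeting
`Γ″_j ∩ Λ₀^{(j)}` with BOTH endpoints in `(Ω″^{∼2}_{h+1})^{(j)}`).  (iv) `M₀` of (1.101) is the constant fixed in [LF-II]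
(1.69); here a parameter.  Every `theorem` is a definitional unfolding or one line of r12's ∕ r11's API; no `Prop` fact
(every `Prop`-valued `def` is a parametrised characteristic function), no `sorry`, no new axiom; nothing of r12's ∕ r11's
files is restated (their declarations are USED by name).  Unit `lit-balaban-p29` (literature-prover-lit-balaban-p29-g41-0).
-/

noncomputable section

namespace Literature.MathematicalPhysics.QuantumFieldTheory.Balaban1983to89.B15Sect1ChartInstances

open Literature.MathematicalPhysics.QuantumFieldTheory.Balaban1983to89
open B15DeterminingSets B15.PrelimIntegrations B15StandardRep B15Sect1Instances GaugeField
open Set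

variable {P : Params} {G : Type*} [GaugeGroup G] {𝔤 : Type*}
variable (χ : LieChart G 𝔤) {av : ∀ j, Averaging P j G} (bg : DetBackground P G av) (M₁ : ℕ)

/-! The Lie algebra `𝔤` carries its norm `|·|` (`NormedAddCommGroup`) where a display tests `|B(b)|`, and its real vector
space structure (`NormedSpace ℝ`) where a display scales (`g_jB_j`, `exp(i s A)`); the instances are introduced section by
section exactly where the displays use them. -/

/-! ## §1  (1.53)₃ p. 187: `B′_j = (1/i) log V′_j` and the scaling `B′_j = g_jB_j`, at print's instance -/

section Eq153

variable (Ω Zpp : ℕ → Set (Site P 0)) (Z : Set (Site P 0)) (h k : ℕ)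

/-- **(1.53), third member** p. 187 [PDF 13], verbatim: *"B′_j = (1/i) log V′_j"* — the chart coordinate of the fluctuation
field `V′_j = V_j(V^{(j)})^{−1}`, `V^{(j)} = M^j(U_k^{(n+1)})` (r11's `fluct153std` = r12's `fluct153` at print's instance),
through the chart of record `LieChart.logI = (1/i) log`. [cite: Balaban1989LargeFieldI, (1.53) p.187] -/
def bPrime153std (n : ℕ) (V : MSField P G) (j : ℕ) : VecField P j 𝔤 :=
  fun b => χ.logI (fluct153std bg Ω Zpp Z h k n V j b)

/-- (1.53)₃ bondwise: `B′_j(b) = (1/i) log V′_j(b)` (definitional). [cite: Balaban1989LargeFieldI, (1.53) p.187] -/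
theorem bPrime153std_apply (n : ℕ) (V : MSField P G) (j : ℕ) (b : PBond P j) :
    bPrime153std χ bg Ω Zpp Z h k n V j b = χ.logI (fluct153std bg Ω Zpp Z h k n V j b) := rfl

/-- (1.53)₃ unfolded: `B′_j(b) = (1/i) log[V_j(b)·(M^j(U_k^{(n+1)}(V))(b))⁻¹]`. [cite: Balaban1989LargeFieldI, (1.53) p.187] -/
theorem bPrime153std_apply' (n : ℕ) (V : MSField P G) (j : ℕ) (b : PBond P j) :
    bPrime153std χ bg Ω Zpp Z h k n V j b =
      χ.logI (V j b * (Averaging.iter av j (bgN bg Ω Zpp Z h k (n + 1) V) b)⁻¹) := rfl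

/-- (1.53)₃ IS r12's schema letter `B15StandardRep.logRatio` (*"(1/i) log[V W⁻¹]"*) at `V := {V_j}`, `W := M˙(U_k^{(n+1)}(V))`
(`avgFamily`), read at scale `j` (definitional). [cite: Balaban1989LargeFieldI, (1.53) p.187] -/
theorem bPrime153std_eq_logRatio (n : ℕ) (V : MSField P G) (j : ℕ) :
    bPrime153std χ bg Ω Zpp Z h k n V j = logRatio χ V (avgFamily av (bgN bg Ω Zpp Z h k (n + 1) V)) j := rfl

variable [NormedAddCommGroup 𝔤]

/-- **p. 187** verbatim: *"This field is small, because |V′_j − 1| ≦ |V_j(V_Z^{(j)})^{−1} − 1| + |V_Z^{(j)}(V^{(j)})^{−1} − 1| <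
3δ′_j, (1.54) … Thus B′_j is small, |B′_j| < 6δ′_j"* — at print's instance: from the (1.27)-restriction at the bond
(`h127`, r11's `chi127std` pointwise), the deferred second smallness (`hsmall`, *"much smaller than δ′_j"*) and the located
chart law `|(1/i) log W| ≦ 2|W − 1|` for `|W − 1| < 3δ′_j` (`hlog`; HONEST SCOPE (i)), via r12's `ineq154`.
[cite: Balaban1989LargeFieldI, (1.54) p.187] -/
theorem norm_bPrime153std_lt {δ'j : ℝ} {n : ℕ} {V : MSField P G} {j : ℕ} {b : PBond P j}
    (h127 : dist1 (V j b * (vZstd bg M₁ Ω Zpp Z h k V j b)⁻¹) < 2 * δ'j)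
    (hsmall : dist1 (vZstd bg M₁ Ω Zpp Z h k V j b *
        (Averaging.iter av j (bgN bg Ω Zpp Z h k (n + 1) V) b)⁻¹) < δ'j)
    (hlog : ∀ W : G, dist1 W < 3 * δ'j → ‖χ.logI W‖ ≤ 2 * dist1 W) :
    ‖bPrime153std χ bg Ω Zpp Z h k n V j b‖ < 6 * δ'j := by
  have h154 : dist1 (fluct153std bg Ω Zpp Z h k n V j b) < 3 * δ'j := ineq154 h127 hsmall
  have h2 := hlog _ h154
  rw [bPrime153std_apply]
  linarith

variable [NormedSpace ℝ 𝔤]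

/-- **p. 187, the scaling** verbatim: *"and finally we perform the scaling transformation B′_j = g_jB_j"* — the rescaled
variable `B_j = g_j⁻¹B′_j` (the letter tested by (1.55)). [cite: Balaban1989LargeFieldI, (1.53) p.187] -/
def bFld153std (gj : ℝ) (n : ℕ) (V : MSField P G) (j : ℕ) : VecField P j 𝔤 :=
  fun b => gj⁻¹ • bPrime153std χ bg Ω Zpp Z h k n V j b

/-- The scaling relation as printed, `B′_j = g_jB_j` (`g_j ≠ 0`). [cite: Balaban1989LargeFieldI, (1.53) p.187] -/
theorem smul_bFld153std {gj : ℝ} (hg : gj ≠ 0) (n : ℕ) (V : MSField P G) (j : ℕ) (b : PBond P j) :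
    gj • bFld153std χ bg Ω Zpp Z h k gj n V j b = bPrime153std χ bg Ω Zpp Z h k n V j b := by
  simp only [bFld153std, smul_smul, mul_inv_cancel₀ hg, one_smul]

end Eq153

/-! ## §2  (1.55) p. 188: `χ′^{(j)}` at print's instance (bond set of record, integration variable `B_j ∈ 𝔤`) -/

section Eq155

variable [NormedAddCommGroup 𝔤] (Ω Zpp : ℕ → Set (Site P 0))

/-- The bond set *"(Ω^c_{j+1}∖Z″_{j+1})^{(j)*}"* of (1.27), (1.55), (1.59): the bonds of `T^{(j)}` meeting
`((Ω_{j+1})ᶜ∖Z″_{j+1})^{(j)}` — verbatim the set of r11's (1.27) instance `chi127std` (`chi127std_iff_bonds155`).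
[cite: Balaban1989LargeFieldI, (1.55) p.188] -/
def bonds155 (j : ℕ) : Set (PBond P j) := bondsOf (pts j ((Ω (j + 1))ᶜ \ Zpp (j + 1)))

/-- Membership in the (1.55) bond set: at least one endpoint in `((Ω_{j+1})ᶜ∖Z″_{j+1})^{(j)}`. [cite: Balaban1989LargeFieldI, (1.55) p.188] -/
theorem mem_bonds155_iff (j : ℕ) (b : PBond P j) :
    b ∈ bonds155 Ω Zpp j ↔
      embIter j b.src ∈ (Ω (j + 1))ᶜ \ Zpp (j + 1) ∨ embIter j b.tgt ∈ (Ω (j + 1))ᶜ \ Zpp (j + 1) := Iff.rfl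

/-- r11's (1.27) instance lives on exactly this bond set (definitional). [cite: Balaban1989LargeFieldI, (1.27) p.182] -/
theorem chi127std_iff_bonds155 (Z : Set (Site P 0)) (h k : ℕ) (δ'j : ℝ) (V : MSField P G) (j : ℕ) :
    chi127std bg M₁ Ω Zpp Z h k δ'j V j ↔
      SF127 (bonds155 Ω Zpp j) δ'j (V j) (vZstd bg M₁ Ω Zpp Z h k V j) := Iff.rfl

/-- **(1.55)** p. 188 [PDF 14], verbatim: *"χ′^{(j)} = χ({|B_j(b)| < δ′_j for b∈(Ω^c_{j+1}∖Z″_{j+1})^{(j)*}})"* — r12's letter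
`SF155` AT print's instance: the bond set `bonds155`, the `𝔤`-valued integration variable `B_j` (the rescaled fluctuation
variable of p. 187), `|·|` = the norm of `𝔤`. [cite: Balaban1989LargeFieldI, (1.55) p.188] -/
def chi155std {j : ℕ} (δ'j : ℝ) (Bj : VecField P j 𝔤) : Prop := SF155 (bonds155 Ω Zpp j) δ'j Bj

/-- (1.55) unfolded at print's instance. [cite: Balaban1989LargeFieldI, (1.55) p.188] -/
theorem chi155std_iff {j : ℕ} (δ'j : ℝ) (Bj : VecField P j 𝔤) :
    chi155std Ω Zpp δ'j Bj ↔ ∀ b ∈ bonds155 Ω Zpp j, ‖Bj b‖ < δ'j := Iff.rfl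

open Classical in
/-- `χ′^{(j)}` as the `{0,1}`-valued function of the integration variable (the characteristic function itself).
[cite: Balaban1989LargeFieldI, (1.55) p.188] -/
def ind155 {j : ℕ} (δ'j : ℝ) (Bj : VecField P j 𝔤) : ℝ := if chi155std Ω Zpp δ'j Bj then 1 else 0

/-- `χ′^{(j)}` takes the values `0`, `1` only. [cite: Balaban1989LargeFieldI, (1.55) p.188] -/
theorem ind155_eq_zero_or_one {j : ℕ} (δ'j : ℝ) (Bj : VecField P j 𝔤) :
    ind155 Ω Zpp δ'j Bj = 0 ∨ ind155 Ω Zpp δ'j Bj = 1 := by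
  unfold ind155; split_ifs <;> simp

/-- **p. 188** verbatim: *"we introduce the decomposition of unity 1 = χ′^{(j)} + (1 − χ′^{(j)})"*. [cite: Balaban1989LargeFieldI, (1.55) p.188] -/
theorem decomp155 {j : ℕ} (δ'j : ℝ) (Bj : VecField P j 𝔤) :
    ind155 Ω Zpp δ'j Bj + (1 - ind155 Ω Zpp δ'j Bj) = 1 := by ring

variable [NormedSpace ℝ 𝔤]

/-- (1.55) read at the image `B_j = g_j⁻¹(1/i) log V′_j` of the old integration variable under (1.53) + scaling (`g_j > 0`):
`χ′^{(j)} = 1` iff `|(1/i) log V′_j(b)| < g_jδ′_j` on the bond set. [cite: Balaban1989LargeFieldI, (1.55) p.188] -/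
theorem chi155std_bFld153std_iff (Z : Set (Site P 0)) (h k : ℕ) {gj : ℝ} (hg : 0 < gj) (δ'j : ℝ) (n : ℕ)
    (V : MSField P G) (j : ℕ) :
    chi155std Ω Zpp δ'j (bFld153std χ bg Ω Zpp Z h k gj n V j) ↔
      ∀ b ∈ bonds155 Ω Zpp j, ‖bPrime153std χ bg Ω Zpp Z h k n V j b‖ < gj * δ'j := by
  simp only [chi155std, SF155, bFld153std]
  refine forall₂_congr fun b _ => ?_
  rw [norm_smul, Real.norm_eq_abs, abs_inv, abs_of_pos hg, inv_mul_lt_iff₀ hg]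

end Eq155

/-! ## §3  (1.59) p. 188: the transformed function `χ({|exp ig_jB_j(b) − 1| < 2δ′_j …})(1 − χ′^{(j)})` -/

section Eq159

variable [NormedAddCommGroup 𝔤] [NormedSpace ℝ 𝔤] (Ω Zpp : ℕ → Set (Site P 0))

/-- **(1.59), first factor** p. 188 [PDF 14], verbatim: *"χ({|exp ig_jB_j(b) − 1| < 2δ′_j for b∈(Ω^c_{j+1}∖Z″_{j+1})^{(j)*}})"* —
r12's letter `SF159` AT print's instance: the tested group element is `exp ig_jB_j(b) = expI (g_j • B_j(b))` through the
chart of record, on the bond set `bonds155`. [cite: Balaban1989LargeFieldI, (1.59) p.188] -/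
def sf159std {j : ℕ} (gj δ'j : ℝ) (Bj : VecField P j 𝔤) : Prop :=
  SF159 (bonds155 Ω Zpp j) δ'j (fun b => χ.expI (gj • Bj b))

/-- (1.59), first factor, unfolded at print's instance. [cite: Balaban1989LargeFieldI, (1.59) p.188] -/
theorem sf159std_iff {j : ℕ} (gj δ'j : ℝ) (Bj : VecField P j 𝔤) :
    sf159std χ Ω Zpp gj δ'j Bj ↔ ∀ b ∈ bonds155 Ω Zpp j, dist1 (χ.expI (gj • Bj b)) < 2 * δ'j := Iff.rfl

/-- **(1.59)** p. 188, the whole function `χ({|exp ig_jB_j(b) − 1| < 2δ′_j …})(1 − χ′^{(j)})` as the event it indicates: the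
first factor holds AND the large-field alternative `1 − χ′^{(j)}` of the decomposition of unity is selected (the (1.55)
condition FAILS).  It is a function of the integration variable `B_j` alone — print: *"in fact it does not depend at all on
the background fields"* (BY CONSTRUCTION: no background argument). [cite: Balaban1989LargeFieldI, (1.59) p.188] -/
def chi159std {j : ℕ} (gj δ'j : ℝ) (Bj : VecField P j 𝔤) : Prop :=
  sf159std χ Ω Zpp gj δ'j Bj ∧ ¬ chi155std Ω Zpp δ'j Bj

/-- (1.59) unfolded at print's instance. [cite: Balaban1989LargeFieldI, (1.59) p.188] -/
theorem chi159std_iff {j : ℕ} (gj δ'j : ℝ) (Bj : VecField P j 𝔤) :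
    chi159std χ Ω Zpp gj δ'j Bj ↔
      (∀ b ∈ bonds155 Ω Zpp j, dist1 (χ.expI (gj • Bj b)) < 2 * δ'j) ∧
        ¬ (∀ b ∈ bonds155 Ω Zpp j, ‖Bj b‖ < δ'j) := Iff.rfl

open Classical in
/-- (1.59) as the `{0,1}`-valued function of `B_j`. [cite: Balaban1989LargeFieldI, (1.59) p.188] -/
def ind159 {j : ℕ} (gj δ'j : ℝ) (Bj : VecField P j 𝔤) : ℝ := if chi159std χ Ω Zpp gj δ'j Bj then 1 else 0

open Classical in
/-- (1.59) IS the printed PRODUCT: the indicator of the first factor times `(1 − χ′^{(j)})`. [cite: Balaban1989LargeFieldI, (1.59) p.188] -/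
theorem ind159_eq_mul {j : ℕ} (gj δ'j : ℝ) (Bj : VecField P j 𝔤) :
    ind159 χ Ω Zpp gj δ'j Bj = (if sf159std χ Ω Zpp gj δ'j Bj then 1 else 0) * (1 - ind155 Ω Zpp δ'j Bj) := by
  unfold ind159 chi159std ind155
  by_cases h1 : sf159std χ Ω Zpp gj δ'j Bj <;> by_cases h2 : chi155std Ω Zpp δ'j Bj <;> simp [h1, h2]

/-- **p. 188** *"This change of variables transforms the function χ′_j(1 − χ′^{(j)}) into [(1.59)]"* — the first factor: under
the substitution effected by the change of variables (1.22) [III] on the printed bond set, `V_j(b)(V_Z^{(j)}(b))⁻¹ =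
exp ig_jB_j(b)` (hypothesis `hsub`; HONEST SCOPE (ii)), r11's (1.27) instance `χ′_j` (`chi127std`) IS the first factor
of (1.59) as a function of `B_j`. [cite: Balaban1989LargeFieldI, (1.59) p.188] -/
theorem chi127std_iff_sf159std_of_subst (Z : Set (Site P 0)) (h k : ℕ) {j : ℕ} {gj δ'j : ℝ} {V : MSField P G}
    {Bj : VecField P j 𝔤}
    (hsub : ∀ b ∈ bonds155 Ω Zpp j, V j b * (vZstd bg M₁ Ω Zpp Z h k V j b)⁻¹ = χ.expI (gj • Bj b)) :
    chi127std bg M₁ Ω Zpp Z h k δ'j V j ↔ sf159std χ Ω Zpp gj δ'j Bj := by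
  simp only [chi127std, SF127, sf159std, SF159, bonds155]
  refine forall₂_congr fun b hb => ?_
  rw [hsub b hb]

/-- Hence the whole product: `χ′_j(1 − χ′^{(j)}) = 1` (in the variables after the substitution) iff (1.59) holds.
[cite: Balaban1989LargeFieldI, (1.59) p.188] -/
theorem chi127std_and_not_chi155std_iff_of_subst (Z : Set (Site P 0)) (h k : ℕ) {j : ℕ} {gj δ'j : ℝ}
    {V : MSField P G} {Bj : VecField P j 𝔤}
    (hsub : ∀ b ∈ bonds155 Ω Zpp j, V j b * (vZstd bg M₁ Ω Zpp Z h k V j b)⁻¹ = χ.expI (gj • Bj b)) :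
    (chi127std bg M₁ Ω Zpp Z h k δ'j V j ∧ ¬ chi155std Ω Zpp δ'j Bj) ↔ chi159std χ Ω Zpp gj δ'j Bj := by
  rw [chi127std_iff_sf159std_of_subst χ bg M₁ Ω Zpp Z h k hsub]
  rfl

/-- At the (1.53)-image `B_j = g_j⁻¹(1/i) log V′_j` of the old variable, and for a chart with `exp i(g_j · g_j⁻¹X) = exp iX`
realised by `expI ∘ logI = id` at the tested elements (located chart law `hexplog`; HONEST SCOPE (i)), the first factor of
(1.59) tests `|V′_j(b) − 1| < 2δ′_j`. [cite: Balaban1989LargeFieldI, (1.59) p.188] -/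
theorem sf159std_bFld153std_iff (Z : Set (Site P 0)) (h k : ℕ) {gj : ℝ} (hg : gj ≠ 0) (δ'j : ℝ) (n : ℕ)
    (V : MSField P G) (j : ℕ)
    (hexplog : ∀ b ∈ bonds155 Ω Zpp j,
      χ.expI (χ.logI (fluct153std bg Ω Zpp Z h k n V j b)) = fluct153std bg Ω Zpp Z h k n V j b) :
    sf159std χ Ω Zpp gj δ'j (bFld153std χ bg Ω Zpp Z h k gj n V j) ↔
      ∀ b ∈ bonds155 Ω Zpp j, dist1 (fluct153std bg Ω Zpp Z h k n V j b) < 2 * δ'j := by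
  simp only [sf159std, SF159]
  refine forall₂_congr fun b hb => ?_
  rw [smul_bFld153std χ bg Ω Zpp Z h k hg, bPrime153std_apply, hexplog b hb]

end Eq159

/-! ## §4  (1.81)–(1.82) pp. 195–196: `Λ₀`, `𝔹₀`, `V₀ = M_{𝔹″_k}(U₀)`, `V′ = V″V₀⁻¹`, `χ′`, `V′ = exp iB′` -/

section Eq182

variable (av)
variable (Ω Zpp : ℕ → Set (Site P 0)) (Z Λ ΩppT2 : Set (Site P 0)) (h k : ℕ)

/-- **p. 195** verbatim: *"denote Λ₀ = Λ∩Ω″^{∼2}_{h+1}"* (`ΩppT2` = the enlarged region `Ω″^{∼2}_{h+1} = Ω^{∼7}_{h+1} =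
(Z′^∼_h)ᶜ` of p. 195, an explicit argument; HONEST SCOPE (iii)). [cite: Balaban1989LargeFieldI, (1.81) p.195] -/
def lambda0 : Set (Site P 0) := Λ ∩ ΩppT2

/-- **p. 195** verbatim: *"the set 𝔹₀ = 𝔹″_k∩Λ₀"* as a determining set: r12's `𝔹″_k = detSetTop` restricted to `Λ₀`
(`DetSet.restrict`, scale by scale `Γ″_j ∩ Λ₀^{(j)}`). [cite: Balaban1989LargeFieldI, (1.81) p.195] -/
def detSetB0 : DetSet P := (detSetTop Ω Zpp Z h k).restrict (lambda0 Λ ΩppT2)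

/-- `𝔹₀` scale by scale: `(𝔹₀)_j = (𝔹″_k)_j ∩ (Λ∩Ω″^{∼2}_{h+1})^{(j)}` (definitional). [cite: Balaban1989LargeFieldI, (1.81) p.195] -/
theorem detSetB0_apply (j : ℕ) :
    detSetB0 Ω Zpp Z Λ ΩppT2 h k j = detSetTop Ω Zpp Z h k j ∩ pts j (Λ ∩ ΩppT2) := rfl

/-- **THE BONDS OF `𝔹₀`, p. 195 convention** verbatim: *"according to our convention, bonds intersecting ∂Λ belong to 𝔹₀,
and bonds intersecting ∂Ω″^{∼2}_{h+1} do not belong to 𝔹₀"* — at scale `j`: the bonds MEETING `(𝔹₀)_j` (r12's `bondsOf`,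
READING (b) of `B15DeterminingSets`: so a bond crossing `∂Λ` is kept) with BOTH endpoints in `(Ω″^{∼2}_{h+1})^{(j)}` (so a
bond crossing `∂Ω″^{∼2}_{h+1}` is dropped). [cite: Balaban1989LargeFieldI, (1.81) p.195] -/
def bondsB0 (j : ℕ) : Set (PBond P j) :=
  {b | b ∈ bondsOf (detSetB0 Ω Zpp Z Λ ΩppT2 h k j) ∧ embIter j b.src ∈ ΩppT2 ∧ embIter j b.tgt ∈ ΩppT2}

/-- Membership in the bonds of `𝔹₀`, unfolded. [cite: Balaban1989LargeFieldI, (1.81) p.195] -/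
theorem mem_bondsB0_iff (j : ℕ) (b : PBond P j) :
    b ∈ bondsB0 Ω Zpp Z Λ ΩppT2 h k j ↔
      (b.src ∈ detSetB0 Ω Zpp Z Λ ΩppT2 h k j ∨ b.tgt ∈ detSetB0 Ω Zpp Z Λ ΩppT2 h k j) ∧
        embIter j b.src ∈ ΩppT2 ∧ embIter j b.tgt ∈ ΩppT2 := Iff.rfl

/-- The bonds of `𝔹₀` are among the bonds meeting `𝔹₀`. [cite: Balaban1989LargeFieldI, (1.81) p.195] -/
theorem bondsB0_subset_bondsOf (j : ℕ) : bondsB0 Ω Zpp Z Λ ΩppT2 h k j ⊆ bondsOf (detSetB0 Ω Zpp Z Λ ΩppT2 h k j) :=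
  fun _ hb => hb.1

/-- The convention, second half: a bond with an endpoint outside `Ω″^{∼2}_{h+1}` (a bond *"intersecting ∂Ω″^{∼2}_{h+1}"*, or
beyond) does NOT belong to `𝔹₀`. [cite: Balaban1989LargeFieldI, (1.81) p.195] -/
theorem not_mem_bondsB0_of_not_mem {j : ℕ} {b : PBond P j}
    (hb : embIter j b.src ∉ ΩppT2 ∨ embIter j b.tgt ∉ ΩppT2) : b ∉ bondsB0 Ω Zpp Z Λ ΩppT2 h k j := by
  rintro ⟨_, hs, ht⟩
  rcases hb with hb | hb
  · exact hb hs
  · exact hb ht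

/-- The convention, first half: a bond with one endpoint in `(𝔹₀)_j` and BOTH endpoints in `(Ω″^{∼2}_{h+1})^{(j)}` — e.g. a
bond *"intersecting ∂Λ"* from a point of `Γ″_j ∩ Λ₀^{(j)}` to a point of `Λᶜ ∩ Ω″^{∼2}_{h+1}` — DOES belong to `𝔹₀`.
[cite: Balaban1989LargeFieldI, (1.81) p.195] -/
theorem mem_bondsB0_of_src_mem {j : ℕ} {b : PBond P j} (hs : b.src ∈ detSetB0 Ω Zpp Z Λ ΩppT2 h k j)
    (ht : embIter j b.tgt ∈ ΩppT2) : b ∈ bondsB0 Ω Zpp Z Λ ΩppT2 h k j :=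
  ⟨Or.inl hs, hs.2.2, ht⟩

/-- **(1.81)** p. 195 [PDF 21], verbatim: *"V₀ = M_{𝔹″_k}(U₀)"* — the averages of the background `U₀` of (1.79) as a
multi-scale field ([III] (2.11) `M_𝐁(U) = M^j(U)` on `Γ_j`: r12's `avgFamily`, compared on `𝔹″_k` ∕ `𝔹₀` only).
[cite: Balaban1989LargeFieldI, (1.81) p.195] -/
def v0std181 (U₀ : GaugeField P 0 G) : MSField P G := avgFamily av U₀

/-- `V₀` at scale `j` is `M^j(U₀)` (definitional). [cite: Balaban1989LargeFieldI, (1.81) p.195] -/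
theorem v0std181_apply (U₀ : GaugeField P 0 G) (j : ℕ) : v0std181 av U₀ j = Averaging.iter av j U₀ := rfl

/-- `V₀` at PRINT'S `U₀ = U_{k,Z}(V_Λ)` of (1.79) (r11's `bgU0std`): `V₀ = M˙(U_{k,Z}(V_Λ))`. [cite: Balaban1989LargeFieldI, (1.81) p.195, (1.79) p.195] -/
theorem v0std181_bgU0std (VΛ : GaugeField P k G) (j : ℕ) :
    v0std181 av (bgU0std bg M₁ Z k VΛ) j = Averaging.iter av j (bgKZstd bg M₁ Z k VΛ) := rfl

/-- **(1.81)** p. 195, verbatim: *"We put V″ = V′V₀ on Λ₀ … (1.81)"* read as the DEFINITION of the fluctuation field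
`V′ = V″V₀⁻¹` scale by scale (r12's bondwise quotient `fluct153`; the printed product form is r12's `fluct181_eq`).
[cite: Balaban1989LargeFieldI, (1.81) p.195] -/
def vPrime181 (V'' : MSField P G) (U₀ : GaugeField P 0 G) : MSField P G :=
  fun j => fluct153 (V'' j) (v0std181 av U₀ j)

/-- (1.81) as printed: `V′V₀ = V″` bondwise (r12's `fluct181_eq`). [cite: Balaban1989LargeFieldI, (1.81) p.195] -/
theorem vPrime181_mul_v0 (V'' : MSField P G) (U₀ : GaugeField P 0 G) (j : ℕ) (b : PBond P j) :
    vPrime181 av V'' U₀ j b * v0std181 av U₀ j b = V'' j b := fluct181_eq _ _ _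

/-- **p. 196** *"V′ = exp iB′"* read backwards in the chart: `B′ = (1/i) log V′ = (1/i) log[V″V₀⁻¹]` — r12's schema letter
`logRatio` at `(V″, M˙(U₀))`. [cite: Balaban1989LargeFieldI, (1.82) p.196] -/
def bPrime181 (V'' : MSField P G) (U₀ : GaugeField P 0 G) : (j : ℕ) → VecField P j 𝔤 :=
  logRatio χ V'' (v0std181 av U₀)

/-- `B′(b) = (1/i) log V′(b)` bondwise (definitional). [cite: Balaban1989LargeFieldI, (1.82) p.196] -/
theorem bPrime181_apply (V'' : MSField P G) (U₀ : GaugeField P 0 G) (j : ℕ) (b : PBond P j) :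
    bPrime181 χ av V'' U₀ j b = χ.logI (vPrime181 av V'' U₀ j b) := rfl

/-- **p. 196** verbatim: *"and V′ = exp iB′"* — the fluctuation field as a function of the new integration variable `B′`,
through the chart of record. [cite: Balaban1989LargeFieldI, (1.82) p.196] -/
def vOfB182 (B' : (j : ℕ) → VecField P j 𝔤) : MSField P G := fun j b => χ.expI (B' j b)

variable [NormedAddCommGroup 𝔤]

/-- **(1.82)** p. 196 [PDF 22], verbatim: *"χ′ = χ({|B′(b)| < δ′_k for b∈𝔹₀}), (1.82)"* — r12's letter `SF182` AT print's
instance: the `𝔤`-valued integration variable `B′` on the bonds of `𝔹₀` (all scales of the determining set, `bondsB0`),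
`|·|` = the norm of `𝔤`, `δ′_k` the number of (1.27) at `j = k`. [cite: Balaban1989LargeFieldI, (1.82) p.196] -/
def chiPrime182std (δ'k : ℝ) (B' : (j : ℕ) → VecField P j 𝔤) : Prop :=
  ∀ j, SF182 (bondsB0 Ω Zpp Z Λ ΩppT2 h k j) δ'k (B' j)

/-- (1.82) unfolded at print's instance. [cite: Balaban1989LargeFieldI, (1.82) p.196] -/
theorem chiPrime182std_iff (δ'k : ℝ) (B' : (j : ℕ) → VecField P j 𝔤) :
    chiPrime182std Ω Zpp Z Λ ΩppT2 h k δ'k B' ↔ ∀ j, ∀ b ∈ bondsB0 Ω Zpp Z Λ ΩppT2 h k j, ‖B' j b‖ < δ'k := Iff.rfl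

/-- (1.82) read at the chart coordinate `B′ = (1/i) log[V″V₀⁻¹]` of the old variables: `χ′ = 1` iff
`|(1/i) log[V″(b)M^j(U₀)(b)⁻¹]| < δ′_k` on every bond of `𝔹₀`. [cite: Balaban1989LargeFieldI, (1.82) p.196] -/
theorem chiPrime182std_bPrime181_iff (δ'k : ℝ) (V'' : MSField P G) (U₀ : GaugeField P 0 G) :
    chiPrime182std Ω Zpp Z Λ ΩppT2 h k δ'k (bPrime181 χ av V'' U₀) ↔
      ∀ j, ∀ b ∈ bondsB0 Ω Zpp Z Λ ΩppT2 h k j,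
        ‖χ.logI (V'' j b * (Averaging.iter av j U₀ b)⁻¹)‖ < δ'k := Iff.rfl

open Classical in
/-- `χ′` as the `{0,1}`-valued function of the integration variable `B′`. [cite: Balaban1989LargeFieldI, (1.82) p.196] -/
def ind182 (δ'k : ℝ) (B' : (j : ℕ) → VecField P j 𝔤) : ℝ :=
  if chiPrime182std Ω Zpp Z Λ ΩppT2 h k δ'k B' then 1 else 0

/-- `χ′` takes the values `0`, `1` only. [cite: Balaban1989LargeFieldI, (1.82) p.196] -/
theorem ind182_eq_zero_or_one (δ'k : ℝ) (B' : (j : ℕ) → VecField P j 𝔤) :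
    ind182 Ω Zpp Z Λ ΩppT2 h k δ'k B' = 0 ∨ ind182 Ω Zpp Z Λ ΩppT2 h k δ'k B' = 1 := by
  unfold ind182; split_ifs <;> simp

/-- **p. 196** verbatim: *"by the decomposition of unity 1 = χ′ + (1 − χ′)"*. [cite: Balaban1989LargeFieldI, (1.82) p.196] -/
theorem decomp182 (δ'k : ℝ) (B' : (j : ℕ) → VecField P j 𝔤) :
    ind182 Ω Zpp Z Λ ΩppT2 h k δ'k B' + (1 - ind182 Ω Zpp Z Λ ΩppT2 h k δ'k B') = 1 := by ring

variable [NormedSpace ℝ 𝔤]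

/-- `V″ = V′V₀ = (exp iB′)·M^j(U₀)` in the variable `B′` — r12's schema letter `expMul` (*"exp(i s A)·U"*) at `s = 1`,
`A = B′_j`, `U = M^j(U₀)`. [cite: Balaban1989LargeFieldI, (1.81) p.195, (1.82) p.196] -/
def vDoublePrime182 (B' : (j : ℕ) → VecField P j 𝔤) (U₀ : GaugeField P 0 G) : MSField P G :=
  fun j => expMul χ 1 (B' j) (v0std181 av U₀ j)

/-- `V″(b) = exp iB′(b) · M^j(U₀)(b)` bondwise. [cite: Balaban1989LargeFieldI, (1.81) p.195] -/
theorem vDoublePrime182_apply (B' : (j : ℕ) → VecField P j 𝔤) (U₀ : GaugeField P 0 G) (j : ℕ) (b : PBond P j) :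
    vDoublePrime182 χ av B' U₀ j b = χ.expI (B' j b) * Averaging.iter av j U₀ b := by
  show χ.expI ((1 : ℝ) • B' j b) * v0std181 av U₀ j b = _
  rw [one_smul]
  rfl

/-- Consistency of (1.81) with (1.82): the fluctuation field of `V″ = (exp iB′)V₀` IS `exp iB′` (group law only, no chart
law needed). [cite: Balaban1989LargeFieldI, (1.82) p.196] -/
theorem vPrime181_vDoublePrime182 (B' : (j : ℕ) → VecField P j 𝔤) (U₀ : GaugeField P 0 G) :
    vPrime181 av (vDoublePrime182 χ av B' U₀) U₀ = vOfB182 χ B' := by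
  funext j b
  simp only [vPrime181, fluct153, vDoublePrime182_apply, vOfB182, v0std181_apply, mul_inv_cancel_right]

/-- … and its chart coordinate is `B′` itself wherever the chart law `(1/i) log (exp iX) = X` holds at the tested values
(located hypothesis `hlogexp`; HONEST SCOPE (i)). [cite: Balaban1989LargeFieldI, (1.82) p.196] -/
theorem bPrime181_vDoublePrime182 (B' : (j : ℕ) → VecField P j 𝔤) (U₀ : GaugeField P 0 G) {j : ℕ} {b : PBond P j}
    (hlogexp : χ.logI (χ.expI (B' j b)) = B' j b) :
    bPrime181 χ av (vDoublePrime182 χ av B' U₀) U₀ j b = B' j b := by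
  rw [bPrime181_apply, congrFun (congrFun (vPrime181_vDoublePrime182 χ av B' U₀) j) b]
  exact hlogexp

/-- Conversely, the old variable is recovered from its chart coordinate, `V″ = (exp iB′)V₀` with `B′ = (1/i) log[V″V₀⁻¹]`,
wherever `exp i((1/i) log W) = W` holds at `W = V′(b)` (located hypothesis `hexplog`). [cite: Balaban1989LargeFieldI, (1.81) p.195] -/
theorem vDoublePrime182_bPrime181 (V'' : MSField P G) (U₀ : GaugeField P 0 G) {j : ℕ} {b : PBond P j}
    (hexplog : χ.expI (χ.logI (vPrime181 av V'' U₀ j b)) = vPrime181 av V'' U₀ j b) :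
    vDoublePrime182 χ av (bPrime181 χ av V'' U₀) U₀ j b = V'' j b := by
  rw [vDoublePrime182_apply, bPrime181_apply, hexplog]
  exact vPrime181_mul_v0 av V'' U₀ j b

end Eq182

/-! ## §5  (1.101) p. 201: `χ(Λ_i)` at print's instance -/

section Eq1101

variable [NormedAddCommGroup 𝔤] (Λi : Set (Site P 0)) (k : ℕ)

/-- **(1.101)** p. 201 [PDF 27], verbatim: *"χ(Λ_i) = χ({|(1/i) log V′(b)| < M₀ε_k for b∈Λ_i}). (1.101)"* — r12's letter
`B15.BasicStep.Chi101` AT print's instance: the size `|(1/i) log V′(b)|` = the norm of the chart coordinate `logI (V′(b))` of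
the scale-`k` fluctuation variable `V′ = V′_k` of the insert of (1.100), the bond range = the bonds of `T^{(k)}` meeting
`Λ_i^{(k)}` (the variables `V′↾_{Λ_i}` integrated in the denominator of (1.100)), `M₀` the constant fixed in [LF-II] (1.69)
(a parameter here; HONEST SCOPE (iv)). [cite: Balaban1989LargeFieldI, (1.101) p.201] -/
def chi101std (M₀ εk : ℝ) (V' : GaugeField P k G) : Prop :=
  B15.BasicStep.Chi101 (fun b => ‖χ.logI (V' b)‖) (bondsOf (pts k Λi)) M₀ εk

omit [GaugeGroup G] in
/-- (1.101) unfolded at print's instance. [cite: Balaban1989LargeFieldI, (1.101) p.201] -/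
theorem chi101std_iff (M₀ εk : ℝ) (V' : GaugeField P k G) :
    chi101std χ Λi k M₀ εk V' ↔ ∀ b ∈ bondsOf (pts k Λi), ‖χ.logI (V' b)‖ < M₀ * εk := Iff.rfl

/-- (1.101) at the fluctuation `V′_k = V_kV_{Λ_i}^{−1}` of the scale-`k` variable around Proposition 1's minimizer `V_{Λ_i}`
(the insert `δ_{G_i}(V′_k)χ(Λ_i)exp[−g_k⁻²A(ζ_i, U_{k,X_i}(V′_kV_{Λ_i}))]` of (1.100); r12's `fluct153` quotient).
[cite: Balaban1989LargeFieldI, (1.101) p.201, (1.100) p.201] -/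
def chi101stdFluct (M₀ εk : ℝ) (Vk VΛ : GaugeField P k G) : Prop := chi101std χ Λi k M₀ εk (fluct153 Vk VΛ)

/-- (1.101) at `V′_k = V_kV_{Λ_i}^{−1}`, unfolded. [cite: Balaban1989LargeFieldI, (1.101) p.201] -/
theorem chi101stdFluct_iff (M₀ εk : ℝ) (Vk VΛ : GaugeField P k G) :
    chi101stdFluct χ Λi k M₀ εk Vk VΛ ↔ ∀ b ∈ bondsOf (pts k Λi), ‖χ.logI (Vk b * (VΛ b)⁻¹)‖ < M₀ * εk := Iff.rfl

/-- The insert's reconstruction `V′_kV_{Λ_i} = V_k` bondwise (r12's `fluct181_eq`). [cite: Balaban1989LargeFieldI, (1.100) p.201] -/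
theorem fluct_mul_vLambda (Vk VΛ : GaugeField P k G) (b : PBond P k) : fluct153 Vk VΛ b * VΛ b = Vk b :=
  fluct181_eq _ _ _

open Classical in
/-- `χ(Λ_i)` as the `{0,1}`-valued function of the fluctuation variable (r12's density form is
`B15Sect1Statements.chi101Density` over an abstract size letter; this is its chart instance). [cite: Balaban1989LargeFieldI, (1.101) p.201] -/
def ind1101 (M₀ εk : ℝ) (V' : GaugeField P k G) : ℝ := if chi101std χ Λi k M₀ εk V' then 1 else 0

omit [GaugeGroup G] in
/-- `χ(Λ_i)` takes the values `0`, `1` only. [cite: Balaban1989LargeFieldI, (1.101) p.201] -/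
theorem ind1101_eq_zero_or_one (M₀ εk : ℝ) (V' : GaugeField P k G) :
    ind1101 χ Λi k M₀ εk V' = 0 ∨ ind1101 χ Λi k M₀ εk V' = 1 := by
  unfold ind1101; split_ifs <;> simp

end Eq1101

end Literature.MathematicalPhysics.QuantumFieldTheory.Balaban1983to89.B15Sect1ChartInstances

end
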